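import Summits.Ventures.PercRepro.RankLevelSetUpFiveLongLine
import Summits.Ventures.PercRepro.RankLevelSetUpFiveBadA

/-! # RankLevelSetUpFiveLineFive — THE TARGET COUNTS OF A BAD MEMBER ON A FIVE-POINT LINE OF A SIMPLE DUAL
(night-1 g44; dossier §56.5, the case `s = 1`)

When the line `cl L'` of a bad member `W` has a fifth point `s₀ ∈ W`: (type B, `b ∉ cl L'`) a hyperplane `cl R`
not containing `L'` meets the line in at most one point, which is `s₀ ∈ R`, so every point of `L'` is admissible for
every coloop and a valid coloop gives `4 · 2 = 8` type-B targets (**`eight_le_ncard_typeBTargets_of_line_five`**);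
(type A, `b ∈ cl L'`, i.e. `s₀ = b`) every pair of points of `L'` is admissible (at most one point of `L'` lies in
`cl R`, which misses `b`), so the `6 · 3 = 18` type-A pairs `((W ∖ b) ∪ {ℓ, ℓ'}, t)`, `t ∈ C`, are targets
(**`eighteen_le_ncard_typeATargets`**); a type-A pair `(Z, t)` has at most `C(6, 2) = 15` preimages `W = (Z ∖ P) ∪ b`
(**`ncard_typeA_preimages_le_fifteen`**). Every declaration has a docstring; imports: the cell's own modules and
Mathlib only. Axioms: standard. -/

namespace PercRepro

open Set Matroid

variable {α : Type}

/-- **The point of the line inside `cl R` absorbs the points of `W` on the line** (simple version of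
`ncard_inter_closure_add_le_two`): `S ⊆ cl L' ∩ cl R` disjoint from `L'` gives `#(L' ∩ cl R) + #S ≤ 1`. -/
lemma ncard_inter_closure_add_le_one {N : Matroid α} [N.Finite] {L' R S : Set α} (hLE : L' ⊆ N.E)
    (hnl : ∀ e ∈ N.E, N.IsNonloop e) (hs : ∀ p ∈ N.E, ∀ q ∈ N.E, p ≠ q → q ∉ N.closure {p})
    (hL2 : N.eRk L' ≤ 2) (hLH : ¬ L' ⊆ N.closure R) (hS : S ⊆ N.closure L' ∩ N.closure R)
    (hSL : Disjoint S L') : (L' ∩ N.closure R).ncard + S.ncard ≤ 1 := by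
  have h := ncard_closure_inter_closure_le_one hLE hnl hs hL2 hLH
  have hXfin : (N.closure L' ∩ N.closure R).Finite :=
    N.ground_finite.subset (Set.inter_subset_left.trans (N.closure_subset_ground L'))
  have hsub : (L' ∩ N.closure R) ∪ S ⊆ N.closure L' ∩ N.closure R := by
    intro x hx
    rcases hx with hx | hx
    · exact ⟨N.subset_closure L' hLE hx.1, hx.2⟩
    · exact hS hx
  have hdj : Disjoint (L' ∩ N.closure R) S := by
    rw [Set.disjoint_left]
    intro x hx hxS
    exact hSL.notMem_of_mem_left hxS hx.1
  have hle : ((L' ∩ N.closure R) ∪ S).ncard ≤ 1 := (Set.ncard_le_ncard hsub hXfin).trans h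
  rw [Set.ncard_union_eq hdj (hXfin.subset (hsub.trans' Set.subset_union_left))
    (hXfin.subset (hsub.trans' Set.subset_union_right))] at hle
  exact hle

/-- **EIGHT TYPE-B TARGETS ON A FIVE-POINT LINE** (night-1 g44, §56.5, `s = 1`): the hypotheses of
`six_le_ncard_typeBTargets_of_simple` plus a fifth point `s₀ ∈ W ∖ b` of the line `cl L'`. Then at least eight
type-B targets. -/
theorem eight_le_ncard_typeBTargets_of_line_five {N : Matroid α} [N.Finite] (h5 : N.eRank = 5)
    (hnl : ∀ e ∈ N.E, N.IsNonloop e) (hs : ∀ p ∈ N.E, ∀ q ∈ N.E, p ≠ q → q ∉ N.closure {p})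
    {W : Set α} (hW : N.IsBase W) {b : α} (hb : b ∈ W) {L' : Set α} (hLE : L' ⊆ N.E) (hL : N.eRk L' = 2)
    (hL4 : L'.ncard = 4) (hbL : b ∉ N.closure L') {c₁ c₂ c₃ : α} (hc₁ : c₁ ∈ N.E) (hc₂ : c₂ ∈ N.E)
    (hc₃ : c₃ ∈ N.E) (h12 : c₁ ≠ c₂) (h13 : c₁ ≠ c₃) (h23 : c₂ ≠ c₃)
    (hC : N.eRk (insert c₁ (insert c₂ (insert c₃ L'))) = 5)
    (hCL : Disjoint ({c₁, c₂, c₃} : Set α) L') (hRL : Disjoint (W \ {b}) L')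
    {s₀ : α} (hs₀ : s₀ ∈ W \ {b}) (hs₀L : s₀ ∈ N.closure L') :
    8 ≤ (typeBTargets N (W \ {b}) L' {c₁, c₂, c₃} b).ncard := by
  classical
  obtain ⟨c, hcC, hval, ℓ, hℓ, hℓc⟩ := exists_useful_coloop h5 hnl (no_triple_of_simple hs) hW hb hLE hL
    (by omega) hbL hc₁ hc₂ hc₃ hC
  have hCE : ({c₁, c₂, c₃} : Set α) ⊆ N.E := by
    intro x hx
    rcases hx with rfl | rfl | rfl
    · exact hc₁
    · exact hc₂
    · exact hc₃
  have hcard3 : ({c₁, c₂, c₃} : Set α).ncard = 3 := by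
    rw [Set.ncard_insert_of_notMem (by simp [h12, h13]), Set.ncard_insert_of_notMem (by simp [h23]),
      Set.ncard_singleton]
  have hcard2 : (({c₁, c₂, c₃} : Set α) \ {c}).ncard = 2 := by
    rw [Set.ncard_sdiff_singleton_of_mem hcC, hcard3]
  have hΛ : 4 ≤ {ℓ ∈ L' | ¬ ({ℓ, c} ⊆ N.closure (W \ {b}))}.ncard := by
    by_cases hLH : L' ⊆ N.closure (W \ {b})
    · have hcH : c ∉ N.closure (W \ {b}) := fun hc =>
        hℓc (Set.insert_subset (hLH hℓ) (Set.singleton_subset_iff.mpr hc))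
      rw [lambda_eq_of_notMem L' (W \ {b}) hcH, hL4]
    · -- the fifth point `s₀` is the only point of the line in `cl R`, so `L' ∩ cl R = ∅`
      have hS : ({s₀} : Set α) ⊆ N.closure L' ∩ N.closure (W \ {b}) := by
        rw [Set.singleton_subset_iff]
        exact ⟨hs₀L, N.subset_closure (W \ {b}) (Set.sdiff_subset.trans hW.subset_ground) hs₀⟩
      have hSL : Disjoint ({s₀} : Set α) L' := by
        rw [Set.disjoint_singleton_left]
        exact fun h => hRL.notMem_of_mem_left hs₀ h
      have h1 := ncard_inter_closure_add_le_one hLE hnl hs hL.le hLH hS hSL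
      rw [Set.ncard_singleton] at h1
      have h0 : L' ∩ N.closure (W \ {b}) = ∅ := by
        rw [← Set.ncard_eq_zero (N.ground_finite.subset (Set.inter_subset_left.trans hLE))]; omega
      have hsub : L' ⊆ {ℓ ∈ L' | ¬ ({ℓ, c} ⊆ N.closure (W \ {b}))} := by
        intro x hx
        refine ⟨hx, fun h => ?_⟩
        have : x ∈ L' ∩ N.closure (W \ {b}) := ⟨hx, h (Set.mem_insert x {c})⟩
        rw [h0] at this
        exact this
      have := Set.ncard_le_ncard hsub ((N.ground_finite.subset hLE).subset (fun x hx => hx.1))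
      omega
  have h := ncard_typeBTargets_ge hLE hCE hRL hCL hcC hval
  rw [hcard2] at h
  omega

/-! ## Type A: the marked element on the line -/

/-- **EIGHTEEN TYPE-A TARGETS** (night-1 g44, §56.5, type A): `N` of rank `5`, loopless and simple; `W` a base through
`b`, `L'` of rank `2` with four points, `b ∈ cl L'`, `C` of three elements disjoint from `L'` and from `W ∖ b`, with
`C ∪ L'` spanning; then the type-A pairs `((W ∖ b) ∪ P, t)` with `P` a two-point subset of `L'` not inside
`cl (W ∖ b)` and `t ∈ C` number at least `6 · 3 = 18`. -/
theorem eighteen_le_ncard_typeATargets {N : Matroid α} [N.Finite]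
    (hnl : ∀ e ∈ N.E, N.IsNonloop e) (hs : ∀ p ∈ N.E, ∀ q ∈ N.E, p ≠ q → q ∉ N.closure {p})
    {W : Set α} (hW : N.IsBase W) {b : α} (hb : b ∈ W) {L' : Set α} (hLE : L' ⊆ N.E) (hL : N.eRk L' = 2)
    (hL4 : L'.ncard = 4) (hbL : b ∈ N.closure L') {C : Set α} (hCE : C ⊆ N.E) (hC3 : C.ncard = 3)
    (hRL : Disjoint (W \ {b}) L') :
    18 ≤ {τ : Set α × α | ∃ P ⊆ L', P.ncard = 2 ∧ ¬ (P ⊆ N.closure (W \ {b})) ∧ τ.1 = (W \ {b}) ∪ P ∧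
      τ.2 ∈ C}.ncard := by
  classical
  have hLfin : L'.Finite := N.ground_finite.subset hLE
  have hCfin : C.Finite := N.ground_finite.subset hCE
  -- `b ∉ cl (W ∖ b)`, so `L' ⊄ cl (W ∖ b)` and at most one point of `L'` lies in `cl (W ∖ b)`
  have hbH : b ∉ N.closure (W \ {b}) := hW.indep.notMem_closure_sdiff_of_mem hb
  have hLH : ¬ L' ⊆ N.closure (W \ {b}) := fun h =>
    hbH (N.closure_subset_closure_of_subset_closure h hbL)
  have h1 := ncard_inter_closure_le_one hLE hnl hs hL.le hLH
  -- every two-point subset of `L'` is admissible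
  have hadm : ∀ P ⊆ L', P.ncard = 2 → ¬ (P ⊆ N.closure (W \ {b})) := by
    intro P hPL hP2 hPH
    have : P ⊆ L' ∩ N.closure (W \ {b}) := fun x hx => ⟨hPL hx, hPH hx⟩
    have := Set.ncard_le_ncard this (N.ground_finite.subset (Set.inter_subset_left.trans hLE))
    omega
  -- the domain: two-point subsets of `L'` times `C`
  let D : Finset (Finset α × α) := (hLfin.toFinset.powersetCard 2) ×ˢ hCfin.toFinset
  have hDcard : D.card = 18 := by
    rw [Finset.card_product, Finset.card_powersetCard, ← Set.ncard_eq_toFinset_card _ hLfin, hL4,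
      ← Set.ncard_eq_toFinset_card _ hCfin, hC3]
    rfl
  rw [← hDcard, ← Set.ncard_coe_finset]
  refine Set.ncard_le_ncard_of_injOn (fun q : Finset α × α => ((W \ {b}) ∪ ↑q.1, q.2)) ?_ ?_ ?_
  · rintro ⟨P, t⟩ hq
    rw [Finset.mem_coe, Finset.mem_product, Finset.mem_powersetCard] at hq
    obtain ⟨⟨hPL, hP2⟩, ht⟩ := hq
    have hPL' : (↑P : Set α) ⊆ L' := fun x hx => hLfin.mem_toFinset.mp (hPL hx)
    have hPc : (↑P : Set α).ncard = 2 := by rw [Set.ncard_coe_finset]; exact hP2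
    exact ⟨↑P, hPL', hPc, hadm _ hPL' hPc, rfl, hCfin.mem_toFinset.mp ht⟩
  · rintro ⟨P, t⟩ hq ⟨P', t'⟩ hq' heq
    rw [Finset.mem_coe, Finset.mem_product, Finset.mem_powersetCard] at hq hq'
    simp only [Prod.mk.injEq] at heq
    obtain ⟨hU, ht⟩ := heq
    have hPL' : (↑P : Set α) ⊆ L' := fun x hx => hLfin.mem_toFinset.mp (hq.1.1 hx)
    have hPL'' : (↑P' : Set α) ⊆ L' := fun x hx => hLfin.mem_toFinset.mp (hq'.1.1 hx)
    have hPR : Disjoint (W \ {b}) (↑P : Set α) := hRL.mono_right hPL'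
    have hPR' : Disjoint (W \ {b}) (↑P' : Set α) := hRL.mono_right hPL''
    have : (↑P : Set α) = ↑P' := by
      have e1 : ((W \ {b}) ∪ ↑P) \ (W \ {b}) = (↑P : Set α) :=
        Set.union_sdiff_cancel_left (Set.disjoint_iff.mp hPR)
      have e2 : ((W \ {b}) ∪ ↑P') \ (W \ {b}) = (↑P' : Set α) :=
        Set.union_sdiff_cancel_left (Set.disjoint_iff.mp hPR')
      rw [← e1, ← e2, hU]
    rw [Prod.mk.injEq]
    exact ⟨Finset.coe_injective this, ht⟩
  · refine ((hLfin.powerset.image (fun P : Set α => (W \ {b}) ∪ P)).prod hCfin).subset ?_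
    rintro ⟨Z, t⟩ ⟨P, hPL, -, -, hZ, ht⟩
    exact ⟨⟨P, hPL, hZ.symm⟩, ht⟩

/-- **A type-A pair has at most fifteen preimages**: `W ↦ Z ∖ W` injects the family of members `W` with
`Z = (W ∖ b) ∪ P` (`P ⊆ Z` two points, `b ∈ W`, `b ∉ Z`) into the two-point subsets of the six-point set `Z`. -/
theorem ncard_typeA_preimages_le_fifteen {b : α} {Z : Set α} (hZfin : Z.Finite) (hZ : Z.ncard = 6) (hbZ : b ∉ Z)
    (𝒲 : Set (Set α)) (h𝒲 : ∀ W ∈ 𝒲, b ∈ W ∧ ∃ P, P.ncard = 2 ∧ Disjoint (W \ {b}) P ∧ Z = (W \ {b}) ∪ P) :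
    𝒲.ncard ≤ 15 := by
  classical
  have himg : ((fun P : Finset α => (↑P : Set α)) '' ↑(hZfin.toFinset.powersetCard 2)).ncard ≤ 15 := by
    refine (Set.ncard_image_le (Finset.finite_toSet _)).trans ?_
    rw [Set.ncard_coe_finset, Finset.card_powersetCard, ← Set.ncard_eq_toFinset_card _ hZfin, hZ]
    decide
  refine le_trans (Set.ncard_le_ncard_of_injOn (fun W => Z \ W) ?_ ?_
    ((Finset.finite_toSet _).image _)) himg
  · intro W hW
    obtain ⟨hbW, P, hP2, hPR, hZW⟩ := h𝒲 W hW
    have hPZ : P ⊆ Z := hZW ▸ Set.subset_union_right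
    have hPfin : P.Finite := hZfin.subset hPZ
    refine ⟨hPfin.toFinset, ?_, ?_⟩
    · rw [Finset.mem_coe, Finset.mem_powersetCard]
      refine ⟨fun x hx => hZfin.mem_toFinset.mpr (hPZ (hPfin.mem_toFinset.mp hx)), ?_⟩
      rw [← Set.ncard_eq_toFinset_card _ hPfin, hP2]
    · -- `Z ∖ W = P`
      show (↑(hPfin.toFinset) : Set α) = Z \ W
      rw [hPfin.coe_toFinset, hZW]
      ext x
      simp only [Set.mem_sdiff, Set.mem_union, Set.mem_singleton_iff]
      constructor
      · intro hx
        refine ⟨Or.inr hx, fun hxW => ?_⟩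
        have hxb : x = b := by
          by_contra hne
          exact hPR.notMem_of_mem_right hx ⟨hxW, hne⟩
        apply hbZ
        rw [hZW, ← hxb]
        exact Or.inr hx
      · rintro ⟨hx, hxW⟩
        rcases hx with hx | hx
        · exact absurd hx.1 hxW
        · exact hx
  · intro W hW W' hW' heq
    obtain ⟨hbW, P, -, -, hZW⟩ := h𝒲 W hW
    obtain ⟨hbW', P', -, -, hZW'⟩ := h𝒲 W' hW'
    simp only at heq
    have hWZ : W = (Z \ (Z \ W)) ∪ {b} := by
      ext x
      simp only [Set.mem_union, Set.mem_sdiff, Set.mem_singleton_iff, not_and, not_not]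
      constructor
      · intro hx
        by_cases hxb : x = b
        · exact Or.inr hxb
        · exact Or.inl ⟨hZW ▸ Set.mem_union_left _ ⟨hx, hxb⟩, fun _ => hx⟩
      · rintro (⟨hxZ, hx⟩ | rfl)
        · exact hx hxZ
        · exact hbW
    have hWZ' : W' = (Z \ (Z \ W')) ∪ {b} := by
      ext x
      simp only [Set.mem_union, Set.mem_sdiff, Set.mem_singleton_iff, not_and, not_not]
      constructor
      · intro hx
        by_cases hxb : x = b
        · exact Or.inr hxb
        · exact Or.inl ⟨hZW' ▸ Set.mem_union_left _ ⟨hx, hxb⟩, fun _ => hx⟩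
      · rintro (⟨hxZ, hx⟩ | rfl)
        · exact hx hxZ
        · exact hbW'
    rw [hWZ, hWZ', heq]

end PercRepro
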